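import Summits.QuantumFields.YangMills.Theorems.ParabolicTrajectoryLatticeGapOnTrajectorySplitDefs
import HarnessLib

/-!
# Crux `LatticeGapOnTrajectory` (stmt-QuantumFields-10523): vocabulary of the line
# `sparse-defect-orbit-window` (lead c4) — the ENGINE-INDEPENDENT decay interface and the
# typical-data (sparse-defect) window package

Route-posited objects (D-0016 `<Route><Crux>…Defs` file) for the registered skeleton
`Cruxes/LatticeGapOnTrajectory/Lines/SketchIdeator5-r2.lean` (card
`Cruxes/LatticeGapOnTrajectory/Ideas/sparse-defect-orbit-window.md`, crux-ideate round 2, k5). Nothing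
about mass gaps is asserted here: every `def … : Prop` is a statement some registered stub proves or
consumes; the one theorem is the (proved) bridge from the landed orbit–Kantorovich package.

* §1 `CellDecay` / `CellDecayAlongP` — the engine-independent INTERFACE through which Sub₁
  (`Split.LatticeGapOnTrajectoryLat`) is reached: exponential covariance decay at the cell scale for
  bounded cell-local cell-Lipschitz observables (in the capped orbit weight) under Wilson's torus
  measure, on every torus the crux's clause visits and every family of axis frames of scale
  `t·M^{n_k}`, together with the rough-centre bound and the polynomial resolution clause. It is
  VERBATIM the output inequality of the landed Dobrushin–Shlosman/Kantorovich engine (`KREngine`,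
  p95465), so the two landed deployments (`stub_smoothingToGap` p95642 → `HasLatticeMassGap`;
  `stub_slabClustering` p123095 → `UniformSlabClustering`) re-plumb through it at their single engine
  call sites (`abs_corr_le_far`, `SlabClustering.abs_corr_le_of_layers`); any other mechanism whose
  output is cell-scale covariance decay (the typical-data engine below, a cluster expansion, a
  multiscale engine) feeds the same two deployments.
* §2 `IsTypicalKRWindow`, `HereditarySparse`, `SparseUnder`, `SparseDefectEngine`,
  `TypicalOrbitWindowsAlongP` — the card's typed content: the Dobrushin–Shlosman window package with
  the Kantorovich contraction demanded only for shell data in a product GOOD set, a crude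
  (total-variation Lipschitz) constant `A` for all data, hereditary joint `ε`-sparseness of bad cells
  (under the window kernels given good shells, and under the state), the ANNEALED sparse-defect engine
  (an `∃ κ C₀ c₀` statement uniform in `(A, ε)` subject to `ε (1 + A) ≤ c₀` — NOT a known theorem:
  von Dreifus–Klein–Perez 1995 is its quenched model; it is the registered stub
  `stub_sparseDefectEngine`), and the physics package along the scheme (the registered stub
  `stub_typicalOrbitWindow`, weaker than `OrbitKRWindowsAlongP` in its contraction clause).
* §3 `cellDecayAlongP_of_windowsP` (proved): `KREngine → OrbitKRWindowsAlongP → CellDecayAlongP` —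
  the interface is conservative over the registered okfs physics stub.

References: Dobrushin–Shlosman 1985 (constructive criterion `C_V`); Föllmer 1988 Ch. I §2;
von Dreifus–Klein–Perez, Commun. Math. Phys. 170 (1995) 21; Georgii 2011 Def. 1.23 / §8.2;
Bałaban, Commun. Math. Phys. 122 (1989) 355, (0.35)–(0.37) (large-field suppression).
-/

set_option autoImplicit false

noncomputable section

namespace Summit.QuantumFields.YangMills.Cruxes.LatticeGapOnTrajectory.SparseDefectOrbitWindow

open scoped BigOperators Topology ENNReal ProbabilityTheory
open Filter MeasureTheory
open Literature.Probability.LatticeModels (Specification IsSpecification IsGibbsMeasure glueWith)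
open Literature.MathematicalPhysics.QuantumFieldTheory
open Summit.QuantumFields.YangMills.Theses.ParabolicTrajectory
open Summit.QuantumFields.YangMills.Cruxes.LatticeGapOnTrajectory.OrbitKantorovichFiniteSize

/-! ## §1 The engine-independent decay interface -/

section Interface

variable {μ : Fin 4 → ℕ} {V S : Type} [MeasurableSpace S]

/-- **Cell-scale covariance decay** of a measure `ν` read on cells `cell` in the weight `w`, with
rate `κ` per cell and constant `C₀`: for bounded measurable `f`, `g` reading only the cells `Δf`,
`Δg`, cell-Lipschitz with bounds `δf`, `δg`, at coarse distance `≥ D`,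
`|cov_ν(f, g)| ≤ C₀ (Σ δf)(Σ δg) e^{−κ D}`. Verbatim the conclusion of `KREngine` (p95465) for one
`(cell, w, ν)`; the interface through which both landed deployments consume an engine. -/
def CellDecay (cell : V → CoarseIdx μ) (w : CoarseIdx μ → (V → S) → (V → S) → ℝ)
    (ν : Measure (V → S)) (κ C₀ : ℝ) : Prop :=
  ∀ (f g : (V → S) → ℝ) (Δf Δg : Finset (CoarseIdx μ)) (δf δg : CoarseIdx μ → ℝ) (D : ℕ),
    Measurable f → Measurable g → (∃ B, ∀ σ, |f σ| ≤ B) → (∃ B, ∀ σ, |g σ| ≤ B) →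
    DependsOn f {v | cell v ∈ Δf} → DependsOn g {v | cell v ∈ Δg} →
    IsCellLipBound cell w f δf → IsCellLipBound cell w g δg →
    (∀ x ∈ Δf, ∀ y ∈ Δg, D ≤ cdist x y) →
      |cov[f, g; ν]| ≤ C₀ * (∑ x ∈ Δf, δf x) * (∑ y ∈ Δg, δg y) * Real.exp (-(κ * D))

/-- Cell decay with a nonnegative constant is monotone in the constant and antitone in the rate. -/
theorem CellDecay.mono {cell : V → CoarseIdx μ} {w : CoarseIdx μ → (V → S) → (V → S) → ℝ}
    {ν : Measure (V → S)} {κ κ' C₀ C₀' : ℝ} (h : CellDecay cell w ν κ C₀) (hκ : κ' ≤ κ)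
    (hC₀ : 0 ≤ C₀) (hC : C₀ ≤ C₀') : CellDecay cell w ν κ' C₀' := by
  intro f g Δf Δg δf δg D hf hg hfb hgb hfd hgd hLf hLg hD
  refine (h f g Δf Δg δf δg D hf hg hfb hgb hfd hgd hLf hLg hD).trans ?_
  have hsf : 0 ≤ ∑ x ∈ Δf, δf x := Finset.sum_nonneg fun x _ => hLf.nonneg x
  have hsg : 0 ≤ ∑ y ∈ Δg, δg y := Finset.sum_nonneg fun y _ => hLg.nonneg y
  have hexp : Real.exp (-(κ * D)) ≤ Real.exp (-(κ' * D)) :=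
    Real.exp_le_exp.2 (by nlinarith [Nat.cast_nonneg (α := ℝ) D])
  have h1 : C₀ * (∑ x ∈ Δf, δf x) * (∑ y ∈ Δg, δg y) ≤ C₀' * (∑ x ∈ Δf, δf x) * (∑ y ∈ Δg, δg y) :=
    mul_le_mul_of_nonneg_right (mul_le_mul_of_nonneg_right hC hsf) hsg
  have h0 : 0 ≤ C₀' * (∑ x ∈ Δf, δf x) * (∑ y ∈ Δg, δg y) :=
    mul_nonneg (mul_nonneg (hC₀.trans hC) hsf) hsg
  exact (mul_le_mul_of_nonneg_right h1 (Real.exp_pos _).le).trans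
    (mul_le_mul_of_nonneg_left hexp h0)

end Interface

section Along

variable {G : Type} [Group G] [TopologicalSpace G] [IsTopologicalGroup G] [CompactSpace G]
  [MeasurableSpace G] [BorelSpace G]

/-- **The decay package along the scheme, P-version (`CellDecayAlongP`)** — the engine-independent
interface of Sub₁. There are a cell scale `t ≥ 1` (crux units), a window radius `n₀`, a rate
`κ > 0` per cell, a constant `C₀ ≥ 0`, a `k`-dependent resolution `α_k > 0` with the polynomial
clause `∃ p₀ K₀, ∀ᶠ k, |β_k| α_k ≤ K₀ a_k^{−p₀}`, and rough-centre constants `K_s`, such that for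
every support size `s`, eventually in `k`, on EVERY torus of side `2S+1` with `S ≥ L_k` and for EVERY
family of axis frames of scale `t·M^{n_k}` with at least `2n₀+3` cells per axis, Wilson's torus
measure at `β_k` read on the cells in the capped orbit weight at resolution `α_k` has cell-scale
covariance decay with `(κ, C₀)` AND satisfies the rough-centre bound with radius `n₀` and constant
`K_s`. (Output currency of `KREngine ∧ OrbitKRWindowsAlongP` — `cellDecayAlongP_of_windowsP` — and of
the typical-data route of this line; consumed by the re-plumbed smoothing and slab-clustering stubs.) -/
def CellDecayAlongP (r : LatticeRep G) (M : ℕ) (sch : SpeciesScheme (YMSpecies G)) (n : ℕ → ℕ) :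
    Prop :=
  ∃ (t n₀ : ℕ) (κ C₀ : ℝ) (α : ℕ → ℝ) (K : ℕ → ℝ), 1 ≤ t ∧ 0 < κ ∧ 0 ≤ C₀ ∧ (∀ k, 0 < α k) ∧
    (∃ (p₀ : ℕ) (K₀ : ℝ), ∀ᶠ k in atTop, |sch.β k| * α k ≤ K₀ * ((sch.a k)⁻¹) ^ p₀) ∧
    ∀ s : ℕ, ∀ᶠ k in atTop, ∀ S : ℕ, sch.L k ≤ S →
      ∀ (μ : Fin 4 → ℕ) (q : (i : Fin 4) → ZMod (2 * S + 1) → ZMod (μ i + 1)),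
        (∀ i, 2 * n₀ + 3 ≤ μ i + 1) → (∀ i, IsTorusFrame (2 * S + 1) (t * M ^ n k) (q i)) →
          CellDecay (cellOf q) (orbitWeight r (α k) q)
              (wilsonMeasure (d := 4) (L := 2 * S + 1) r.ρ (sch.β k)) κ C₀ ∧
          RoughCentreBound r (sch.β k) (2 * S + 1) q (α k) n₀ s (K s)

end Along

/-! ## §2 The typical-data (sparse-defect) window package and the annealed engine -/

section Typical

variable {μ : Fin 4 → ℕ} {V S : Type} [Fintype V] [MeasurableSpace S]

/-- **Typical Kantorovich–Rubinstein window package** (`IsTypicalKRWindow`; card §Lever, implementing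
the drefuter's R3): the landed `IsKRWindow` data (`w` a bounded local weight, nonnegative finite-range
influence profile `k` with the RECEIVED sum condition `sum_le`) in which the Dobrushin–Shlosman
contraction `contract` is demanded only when BOTH boundary data have every shell cell of the window
in the GOOD set (`good y`, a measurable event read on cell `y` only — a PRODUCT condition over the
shell, so that one-cell interpolations between good data stay good), plus the CRUDE clause: for all
data, changing one cell `y` outside the window moves the window expectation of a cell-Lipschitz `f`
by at most `A (Σ_x δ x) w y ω η` (total-variation Lipschitz bound of the window kernel in the same
currency; with the R1 resolution `α_k = λ/β_k` the constant is `β`-free, card (iii)). -/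
structure IsTypicalKRWindow (cell : V → CoarseIdx μ) (w : CoarseIdx μ → (V → S) → (V → S) → ℝ)
    (γ : Specification V S) (R : ℝ) (n : ℕ) (γ₀ : ℝ)
    (k : CoarseIdx μ → CoarseIdx μ → CoarseIdx μ → ℝ) (good : CoarseIdx μ → Set (V → S)) (A : ℝ) :
    Prop where
  w_nonneg : ∀ c σ τ, 0 ≤ w c σ τ
  w_le : ∀ c σ τ, w c σ τ ≤ R
  w_local : ∀ (c : CoarseIdx μ) (σ σ' τ τ' : V → S), (∀ v, cell v = c → σ v = σ' v) →
    (∀ v, cell v = c → τ v = τ' v) → w c σ τ = w c σ' τ'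
  k_nonneg : ∀ c y x, 0 ≤ k c y x
  A_nonneg : 0 ≤ A
  good_meas : ∀ y, MeasurableSet (good y)
  good_local : ∀ (y : CoarseIdx μ) (σ τ : V → S), (∀ v, cell v = y → σ v = τ v) →
    (σ ∈ good y ↔ τ ∈ good y)
  range : ∀ (c y : CoarseIdx μ), n + 1 < cdist c y → ∀ (ω η : V → S), (∀ v, cell v ≠ y → ω v = η v) →
    ∀ f : (V → S) → ℝ, Measurable f → (∃ B, ∀ σ, |f σ| ≤ B) →
      DependsOn f {v | cdist c (cell v) ≤ n} →
        windowAvg γ (windowVol cell n c) f ω = windowAvg γ (windowVol cell n c) f η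
  contract : ∀ (c y : CoarseIdx μ), n < cdist c y → ∀ (ω η : V → S), (∀ v, cell v ≠ y → ω v = η v) →
    (∀ y', cdist c y' = n + 1 → ω ∈ good y' ∧ η ∈ good y') →
    ∀ (f : (V → S) → ℝ) (δ : CoarseIdx μ → ℝ), Measurable f → (∃ B, ∀ σ, |f σ| ≤ B) →
      DependsOn f {v | cdist c (cell v) ≤ n} → IsCellLipBound cell w f δ →
        |windowAvg γ (windowVol cell n c) f ω - windowAvg γ (windowVol cell n c) f η| ≤
          (∑ x ∈ Finset.univ.filter (fun x => cdist c x ≤ n), k c y x * δ x) * w y ω η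
  crude : ∀ (c y : CoarseIdx μ), n < cdist c y → ∀ (ω η : V → S), (∀ v, cell v ≠ y → ω v = η v) →
    ∀ (f : (V → S) → ℝ) (δ : CoarseIdx μ → ℝ), Measurable f → (∃ B, ∀ σ, |f σ| ≤ B) →
      DependsOn f {v | cdist c (cell v) ≤ n} → IsCellLipBound cell w f δ →
        |windowAvg γ (windowVol cell n c) f ω - windowAvg γ (windowVol cell n c) f η| ≤
          A * (∑ x ∈ Finset.univ.filter (fun x => cdist c x ≤ n), δ x) * w y ω η
  sum_le : ∀ x : CoarseIdx μ,
    ∑ c ∈ Finset.univ.filter (fun c => cdist c x ≤ n),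
        ∑ y ∈ Finset.univ.filter (fun y => cdist c y = n + 1), k c y x ≤
      γ₀ * (Finset.univ.filter (fun c => cdist c x ≤ n)).card

/-- A sup-form KR window is a typical KR window for ANY family of good sets read on cells (the
contraction holds for all data; crude constant `A = Σ-free bound |W|·sup k` is not needed: take the
contraction itself, `A := sup_{c,y} Σ_x k` suffices — here we record the simplest instance, all data
good and `A` any bound on the row sums). -/
theorem IsTypicalKRWindow.of_isKRWindow {cell : V → CoarseIdx μ}
    {w : CoarseIdx μ → (V → S) → (V → S) → ℝ} {γ : Specification V S} {R : ℝ} {n : ℕ} {γ₀ : ℝ}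
    {k : CoarseIdx μ → CoarseIdx μ → CoarseIdx μ → ℝ} (h : IsKRWindow cell w γ R n γ₀ k) {A : ℝ}
    (hA : ∀ c y x, k c y x ≤ A) (hA0 : 0 ≤ A) :
    IsTypicalKRWindow cell w γ R n γ₀ k (fun _ => Set.univ) A where
  w_nonneg := h.w_nonneg
  w_le := h.w_le
  w_local := h.w_local
  k_nonneg := h.k_nonneg
  A_nonneg := hA0
  good_meas _ := MeasurableSet.univ
  good_local _ _ _ _ := by simp
  range := h.range
  contract c y hcy ω η hωη _ f δ hf hfb hdep hLip := h.contract c y hcy ω η hωη f δ hf hfb hdep hLip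
  crude c y hcy ω η hωη f δ hf hfb hdep hLip := by
    refine (h.contract c y hcy ω η hωη f δ hf hfb hdep hLip).trans ?_
    rw [Finset.mul_sum]
    refine mul_le_mul_of_nonneg_right (Finset.sum_le_sum fun x _ => ?_) (h.w_nonneg _ _ _)
    exact mul_le_mul_of_nonneg_right (hA c y x) (hLip.nonneg x)
  sum_le := h.sum_le

/-- **Hereditary joint sparseness of bad cells under the window kernels** (`HereditarySparse`): for
every window centre `c` and every boundary datum `ω` whose shell cells are all good, and every set `X`
of cells of the window, the window kernel `γ_{W(c)}(· | ω)` gives the event "every cell of `X` is bad"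
probability at most `ε^{|X|}`. (The conditional, jointly exponential form the annealed engine needs;
physically: large fields are suppressed given a tame environment — Bałaban's large-field bound in
conditional form; NOT what a chessboard estimate delivers, which is `SparseUnder`.) -/
def HereditarySparse (cell : V → CoarseIdx μ) (γ : Specification V S) (n : ℕ)
    (good : CoarseIdx μ → Set (V → S)) (ε : ℝ) : Prop :=
  ∀ (c : CoarseIdx μ) (ω : V → S), (∀ y, cdist c y = n + 1 → ω ∈ good y) →
    ∀ X : Finset (CoarseIdx μ), (∀ x ∈ X, cdist c x ≤ n) →
      γ (windowVol cell n c) ω {σ | ∀ x ∈ X, σ ∉ good x} ≤ ENNReal.ofReal (ε ^ X.card)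

/-- **Joint sparseness of bad cells under a state** (`SparseUnder`): `ν(every cell of X is bad) ≤ ε^{|X|}`
for every finite set of cells `X`. -/
def SparseUnder (ν : Measure (V → S)) (good : CoarseIdx μ → Set (V → S)) (ε : ℝ) : Prop :=
  ∀ X : Finset (CoarseIdx μ), ν {σ | ∀ x ∈ X, σ ∉ good x} ≤ ENNReal.ofReal (ε ^ X.card)

end Typical

/-- **The annealed sparse-defect Dobrushin–Shlosman engine** (`SparseDefectEngine`; statement of the
registered stub `stub_sparseDefectEngine` — NOT a known theorem). For window radius `n`, ratio
`γ₀ < 1` and weight bound `R` there are a rate `κ > 0`, a constant `C₀ ≥ 0` and a smallness threshold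
`c₀ > 0` (depending on NOTHING else) such that for every crude constant `A` and sparseness level
`ε ≥ 0` with `ε (1 + A) ≤ c₀`: on every coarse 4-torus with `≥ 2n+3` labels per axis, for every
specification with the typical KR window package `(good, A)` whose bad cells are hereditarily jointly
`ε`-sparse under the window kernels, and every Gibbs measure `ν` of it under which bad cells are
jointly `ε`-sparse, covariances of bounded measurable cell-local cell-Lipschitz observables decay like
`C₀ (Σδ_f)(Σδ_g) e^{−κ D}` — the conclusion of `KREngine` verbatim. The quenched model is von
Dreifus–Klein–Perez, Commun. Math. Phys. 170 (1995) 21 (Dobrushin condition violated on rare FIXED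
regions); the annealed statement (bad regions read off the configuration being integrated) is the
line's open engine: the sup-Lipschitz seminorm of Föllmer's comparison does not contract across bad
pairs, and the total-variation remainder on bad data stays exponentially small along the iteration
only through the JOINT (path) sparseness — card falsifier (1). -/
def SparseDefectEngine : Prop :=
  ∀ (n : ℕ) (γ₀ R : ℝ), 0 ≤ γ₀ → γ₀ < 1 → 0 ≤ R → ∃ κ C₀ c₀ : ℝ, 0 < κ ∧ 0 ≤ C₀ ∧ 0 < c₀ ∧
    ∀ (A ε : ℝ), 0 ≤ ε → ε * (1 + A) ≤ c₀ →
    ∀ (μ : Fin 4 → ℕ) (V S : Type) [Fintype V] [MeasurableSpace S]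
      (cell : V → CoarseIdx μ) (w : CoarseIdx μ → (V → S) → (V → S) → ℝ)
      (γ : Specification V S) (k : CoarseIdx μ → CoarseIdx μ → CoarseIdx μ → ℝ)
      (good : CoarseIdx μ → Set (V → S)),
      (∀ i, 2 * n + 3 ≤ μ i + 1) → IsSpecification γ → IsTypicalKRWindow cell w γ R n γ₀ k good A →
      HereditarySparse cell γ n good ε →
      ∀ ν : Measure (V → S), IsGibbsMeasure γ ν → SparseUnder ν good ε →
      ∀ (f g : (V → S) → ℝ) (Δf Δg : Finset (CoarseIdx μ)) (δf δg : CoarseIdx μ → ℝ) (D : ℕ),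
        Measurable f → Measurable g → (∃ B, ∀ σ, |f σ| ≤ B) → (∃ B, ∀ σ, |g σ| ≤ B) →
        DependsOn f {v | cell v ∈ Δf} → DependsOn g {v | cell v ∈ Δg} →
        IsCellLipBound cell w f δf → IsCellLipBound cell w g δg →
        (∀ x ∈ Δf, ∀ y ∈ Δg, D ≤ cdist x y) →
          |cov[f, g; ν]| ≤ C₀ * (∑ x ∈ Δf, δf x) * (∑ y ∈ Δg, δg y) * Real.exp (-(κ * D))

section Physics

variable {G : Type} [Group G] [TopologicalSpace G] [IsTopologicalGroup G] [CompactSpace G]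
  [MeasurableSpace G] [BorelSpace G]

/-- **Typical orbit–Kantorovich windows along the scheme, P-version** (`TypicalOrbitWindowsAlongP`;
statement of the registered physics stub `stub_typicalOrbitWindow`). As `OrbitKRWindowsAlongP`
(scale `t`, radius `n₀`, ratio `γ₀ < 1`, resolution `α_k > 0` with the polynomial clause, rough-centre
constants `K_s`) except that, on each torus and frame family, Wilson's torus specification is asked
for the TYPICAL package only: SOME family of good cell events `good` and SOME profile `kp` with
`IsTypicalKRWindow … kp good (A k)`, hereditary joint `(ε k)`-sparseness of bad cells under the window
kernels given good shells, and joint `(ε k)`-sparseness under Wilson's torus measure — with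
`k`-sequences `A_k ≥ 0`, `ε_k ≥ 0` (independent of the torus and the frames) and `ε_k (1 + A_k) → 0`.
The only stub of the line using `IsCompactSimpleLieGroup`, `β_k → ∞` and the tuning (Disproof §5
honoured here: for `U(1)` typical shell data transmit the constant-curvature mode, drefute gen-2 §3(c)). -/
def TypicalOrbitWindowsAlongP (r : LatticeRep G) (M : ℕ) (sch : SpeciesScheme (YMSpecies G))
    (n : ℕ → ℕ) : Prop :=
  ∃ (t n₀ : ℕ) (γ₀ : ℝ) (α A ε : ℕ → ℝ) (K : ℕ → ℝ), 1 ≤ t ∧ 0 ≤ γ₀ ∧ γ₀ < 1 ∧ (∀ k, 0 < α k) ∧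
    (∀ k, 0 ≤ ε k) ∧ Tendsto (fun k => ε k * (1 + A k)) atTop (𝓝 0) ∧
    (∃ (p₀ : ℕ) (K₀ : ℝ), ∀ᶠ k in atTop, |sch.β k| * α k ≤ K₀ * ((sch.a k)⁻¹) ^ p₀) ∧
    ∀ s : ℕ, ∀ᶠ k in atTop, ∀ S : ℕ, sch.L k ≤ S →
      ∀ (μ : Fin 4 → ℕ) (q : (i : Fin 4) → ZMod (2 * S + 1) → ZMod (μ i + 1)),
        (∀ i, 2 * n₀ + 3 ≤ μ i + 1) → (∀ i, IsTorusFrame (2 * S + 1) (t * M ^ n k) (q i)) →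
          (∃ (kp : CoarseIdx μ → CoarseIdx μ → CoarseIdx μ → ℝ)
              (good : CoarseIdx μ → Set (GaugeConfig 4 (2 * S + 1) G)),
              IsTypicalKRWindow (cellOf q) (orbitWeight r (α k) q) (torusYM r.ρ (sch.β k) (2 * S + 1))
                1 n₀ γ₀ kp good (A k) ∧
              HereditarySparse (cellOf q) (torusYM r.ρ (sch.β k) (2 * S + 1)) n₀ good (ε k) ∧
              SparseUnder (wilsonMeasure (d := 4) (L := 2 * S + 1) r.ρ (sch.β k)) good (ε k)) ∧
          RoughCentreBound r (sch.β k) (2 * S + 1) q (α k) n₀ s (K s)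

/-! ## §3 The interface is conservative over the landed okfs package -/

/-- **`KREngine ∧ OrbitKRWindowsAlongP ⇒ CellDecayAlongP`** (the okfs bridge): the landed engine
(p95465) applied, torus by torus and frame family by frame family, to Wilson's torus specification
(a specification with Wilson's torus measure as a Gibbs measure, `WilsonTorusDLR`, p95462) under the
registered physics stub's window package gives the decay package with `(κ, C₀) = KREngine(n₀, γ₀, 1)`.
[cite: DobrushinShlosman1985, Theorem] [cite: Follmer1988, Ch. I Theorem (2.13)] -/
theorem cellDecayAlongP_of_windowsP (hE : KREngine) (r : LatticeRep G) (hDLR : WilsonTorusDLR r)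
    {M : ℕ} {sch : SpeciesScheme (YMSpecies G)} {n : ℕ → ℕ} (hW : Split.OrbitKRWindowsAlongP r M sch n) :
    CellDecayAlongP r M sch n := by
  obtain ⟨t, n₀, γ₀, α, K, ht, hγ₀, hγ₁, hα, hP, hrest⟩ := hW
  obtain ⟨κ, C₀, hκ, hC₀, hEng⟩ := hE n₀ γ₀ 1 hγ₀ hγ₁ zero_le_one
  refine ⟨t, n₀, κ, C₀, α, K, ht, hκ, hC₀, hα, hP, fun s => ?_⟩
  filter_upwards [hrest s] with k hk S hS μ q hμ hframe
  obtain ⟨⟨kp, hKR⟩, hRC⟩ := hk S hS μ q hμ hframe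
  obtain ⟨hγ, hGibbs⟩ := hDLR (sch.β k) (2 * S + 1)
  exact ⟨fun f g Δf Δg δf δg D hf hg hfb hgb hfd hgd hLf hLg hD =>
    hEng μ _ _ (cellOf q) (orbitWeight r (α k) q) (torusYM r.ρ (sch.β k) (2 * S + 1)) kp hμ hγ hKR _
      hGibbs f g Δf Δg δf δg D hf hg hfb hgb hfd hgd hLf hLg hD, hRC⟩

end Physics

end Summit.QuantumFields.YangMills.Cruxes.LatticeGapOnTrajectory.SparseDefectOrbitWindow

end
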